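import Mathlib
import Literature.Probability.LatticeModels.PointwiseScalingLimitEtaExists
import HarnessLib

/-!
# Crux `IsingEuclidUpgradeR2RotInvPowerLaw` (stmt-CriticalPhenomena-0634), line `tower_profile_rigidity`:
# glue `towerLaw_of_dyadicDiniLaw` — the dyadic Dini law S1 implies the dyadic tower law T1

Write `G := criticalTwoPoint 3` for the critical two-point function `⟨σ₀σ_x⟩_{β_c}` of the
nearest-neighbour Ising model on `ℤ³` and `g(n) := G(n e₀) > 0` (`criticalTwoPoint_axis_pos`).

* S1 (dyadic Dini law, the rate stub of the superseded line `dyadic_dini_isotropy`):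
  `∃ Δ ω C, 0 < ω ∧ ∀ n ≥ 1, |g(2n)·4^Δ/g(n) − 1| ≤ C n^{−ω}`;
* T1 (dyadic tower law, the hardest stub of the present line):
  `∃ Δ c, 0 < c ∧ g(2^j)·(2^j)^{2Δ} → c`.

**Theorem** (`towerLaw_of_dyadicDiniLaw`, registered glue name, verbatim signature): S1 → T1.

Proof (pure real analysis). Take T1's `Δ` to be S1's `Δ`. Put `ρ := 2^{−ω} ∈ (0,1)`,
`C' := max C 0`, `b_k := log g(2^k) + 2Δ k log 2` and `e_k := g(2^{k+1})·4^Δ/g(2^k) − 1`. S1 at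
`n = 2^k` gives `|e_k| ≤ C' ρ^k`, and `b_{k+1} − b_k = log (1 + e_k)`. Eventually `C' ρ^k ≤ 1/2`, where
`|log (1 + e)| ≤ 2|e|`, so `|b_{k+1} − b_k| ≤ D ρ^k` for all `k` after enlarging the constant by the
finitely many early increments; hence `b` is Cauchy (`cauchySeq_of_le_geometric`) and converges to some
`w`. Finally `g(2^k)·(2^k)^{2Δ} = exp (b_k) → exp w =: c > 0`.

Adapted from the landed crux workfile `Cruxes/DimensionPinned/CensusWeb.lean`, theorem
`dyadicPinned_of_dyadicDiniLaw` (which stops at boundedness of `b`); Cruxes modules are not imported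
from Theorems files, so the argument is repeated here and finished by exponentiation. No definitions
are introduced.
-/

noncomputable section

namespace Summit.CriticalPhenomena.Ising3DConformalLimit.Cruxes.IsingEuclidUpgradeR2RotInvPowerLaw.TowerProfileRigidity

open Filter Topology Literature.Probability.LatticeModels

-- adapted from `abs_log_one_add_le` in Cruxes/DimensionPinned/CensusWeb.lean (crux workfile, not imported)
/-- `|log (1 + e)| ≤ 2|e|` for `|e| ≤ 1/2`. [folklore] -/
private theorem abs_log_one_add_le_two_mul {e : ℝ} (he : |e| ≤ 1 / 2) :
    |Real.log (1 + e)| ≤ 2 * |e| := by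
  have he' := abs_le.1 he
  have hpos : 0 < 1 + e := by linarith
  rw [abs_le]
  constructor
  · have h1 := Real.one_sub_inv_le_log_of_pos hpos
    have h2 : -(2 * |e|) ≤ 1 - (1 + e)⁻¹ := by
      rw [show (1 : ℝ) - (1 + e)⁻¹ = e / (1 + e) by field_simp; ring]
      rcases le_total 0 e with h | h
      · have : 0 ≤ e / (1 + e) := div_nonneg h hpos.le
        linarith [abs_nonneg e]
      · rw [abs_of_nonpos h, le_div_iff₀ hpos]
        nlinarith
    linarith
  · have h1 := Real.log_le_sub_one_of_pos hpos
    linarith [le_abs_self e, abs_nonneg e]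

-- adapted from `two_pow_rpow_neg` in Cruxes/DimensionPinned/CensusWeb.lean (crux workfile, not imported)
/-- `(2^i)^{-ω} = (2^{-ω})^i` for `i : ℕ`, `ω : ℝ`. [folklore] -/
private theorem two_pow_rpow_neg_eq_pow (i : ℕ) (ω : ℝ) :
    ((2 : ℝ) ^ i) ^ (-ω) = ((2 : ℝ) ^ (-ω)) ^ i := by
  rw [← Real.rpow_natCast ((2 : ℝ) ^ (-ω)) i, ← Real.rpow_mul (by norm_num : (0 : ℝ) ≤ 2),
    mul_comm, Real.rpow_mul (by norm_num : (0 : ℝ) ≤ 2), Real.rpow_natCast]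

/-- `exp (2Δ k log 2) = (2^k)^{2Δ}` (natural power cast to `ℝ`, real exponent). [folklore] -/
private theorem exp_two_mul_mul_log_two (Δ : ℝ) (k : ℕ) :
    Real.exp (2 * Δ * k * Real.log 2) = (((2 ^ k : ℕ)) : ℝ) ^ (2 * Δ) := by
  push_cast
  rw [Real.rpow_def_of_pos (pow_pos two_pos k), Real.log_pow]
  congr 1
  ring

-- adapted from `dyadicPinned_of_dyadicDiniLaw` in Cruxes/DimensionPinned/CensusWeb.lean (crux workfile,
-- not imported): same Cauchy argument, finished by exponentiating the limit.
/-- **Glue S1 ⟹ T1** (registered name `towerLaw_of_dyadicDiniLaw`, verbatim signature). A power rate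
`|g(2n)·4^Δ/g(n) − 1| ≤ C n^{−ω}` (`ω > 0`) in the dyadic law makes `k ↦ log g(2^k) + 2Δ k log 2`
Cauchy with geometric increments, hence convergent to some `w`, and then
`g(2^j)·(2^j)^{2Δ} = exp (log g(2^j) + 2Δ j log 2) → exp w > 0`. [folklore] -/
theorem towerLaw_of_dyadicDiniLaw :
    (∃ Δ ω C : ℝ, 0 < ω ∧ ∀ n : ℕ, 1 ≤ n → |Literature.Probability.LatticeModels.criticalTwoPoint 3 (Pi.single 0 ((2 * n : ℕ) : ℤ)) * (4 : ℝ) ^ Δ / Literature.Probability.LatticeModels.criticalTwoPoint 3 (Pi.single 0 ((n : ℕ) : ℤ)) - 1| ≤ C * (n : ℝ) ^ (-ω)) → ∃ Δ c : ℝ, 0 < c ∧ Filter.Tendsto (fun j : ℕ => Literature.Probability.LatticeModels.criticalTwoPoint 3 (Pi.single 0 ((2 ^ j : ℕ) : ℤ)) * ((2 ^ j : ℕ) : ℝ) ^ (2 * Δ)) Filter.atTop (nhds c) := by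
  rintro ⟨Δ, ω, C, hω, hdini⟩
  -- the axis two-point function along `ℕ e₀` and its positivity (tree)
  set g : ℕ → ℝ := fun n => criticalTwoPoint 3 (Pi.single 0 ((n : ℕ) : ℤ)) with hg
  have g_pos : ∀ n : ℕ, 0 < g n := fun n => criticalTwoPoint_axis_pos n
  set C' : ℝ := max C 0 with hC'
  have hC'0 : 0 ≤ C' := le_max_right _ _
  set ρ : ℝ := (2 : ℝ) ^ (-ω) with hρ
  have hρ0 : 0 < ρ := Real.rpow_pos_of_pos two_pos _
  have hρ1 : ρ < 1 := Real.rpow_lt_one_of_one_lt_of_neg one_lt_two (neg_neg_of_pos hω)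
  -- the dyadic log-sequence and its increments
  set b : ℕ → ℝ := fun k => Real.log (g (2 ^ k)) + 2 * Δ * k * Real.log 2 with hb
  set e : ℕ → ℝ := fun k => g (2 ^ (k + 1)) * (4 : ℝ) ^ Δ / g (2 ^ k) - 1 with he
  have hebound : ∀ k : ℕ, |e k| ≤ C' * ρ ^ k := by
    intro k
    have hd := hdini (2 ^ k) Nat.one_le_two_pow
    have e1 : (Pi.single 0 (((2 * 2 ^ k : ℕ)) : ℤ) : Site 3) =
        Pi.single 0 (((2 ^ (k + 1) : ℕ)) : ℤ) := by
      rw [pow_succ']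
    rw [e1] at hd
    have e2 : (((2 ^ k : ℕ)) : ℝ) ^ (-ω) = ρ ^ k := by
      push_cast
      rw [hρ]
      exact two_pow_rpow_neg_eq_pow k ω
    rw [e2] at hd
    refine hd.trans ?_
    exact mul_le_mul_of_nonneg_right (le_max_left _ _) (pow_nonneg hρ0.le k)
  have hincr : ∀ k : ℕ, b (k + 1) - b k = Real.log (1 + e k) := by
    intro k
    have hp0 := g_pos (2 ^ k)
    have hp1 := g_pos (2 ^ (k + 1))
    have h4 : (0 : ℝ) < (4 : ℝ) ^ Δ := Real.rpow_pos_of_pos (by norm_num) _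
    have hlog4 : Real.log ((4 : ℝ) ^ Δ) = 2 * Δ * Real.log 2 := by
      rw [Real.log_rpow (by norm_num : (0 : ℝ) < 4), show (4 : ℝ) = 2 ^ 2 by norm_num, Real.log_pow]
      push_cast
      ring
    simp only [hb, he]
    rw [add_sub_cancel, Real.log_div (mul_pos hp1 h4).ne' hp0.ne', Real.log_mul hp1.ne' h4.ne', hlog4]
    push_cast
    ring
  -- eventually `C' ρ^k ≤ 1/2`
  have hsmall : Tendsto (fun k : ℕ => C' * ρ ^ k) atTop (𝓝 0) := by
    simpa using (tendsto_pow_atTop_nhds_zero_of_lt_one hρ0.le hρ1).const_mul C'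
  obtain ⟨k₀, hk₀⟩ := eventually_atTop.1 (hsmall.eventually (ge_mem_nhds (by norm_num : (0 : ℝ) < 1 / 2)))
  have hδ_large : ∀ k : ℕ, k₀ ≤ k → |b (k + 1) - b k| ≤ 2 * C' * ρ ^ k := by
    intro k hk
    rw [hincr k]
    have hle : |e k| ≤ 1 / 2 := (hebound k).trans (hk₀ k hk)
    calc |Real.log (1 + e k)| ≤ 2 * |e k| := abs_log_one_add_le_two_mul hle
      _ ≤ 2 * (C' * ρ ^ k) := by linarith [hebound k]
      _ = 2 * C' * ρ ^ k := by ring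
  -- a geometric bound valid for ALL k (enlarge the constant by the finitely many early increments)
  set D : ℝ := 2 * C' + ∑ i ∈ Finset.range k₀, |b (i + 1) - b i| / ρ ^ i with hD
  have hDsum : 0 ≤ ∑ i ∈ Finset.range k₀, |b (i + 1) - b i| / ρ ^ i :=
    Finset.sum_nonneg fun i _ => div_nonneg (abs_nonneg _) (pow_nonneg hρ0.le i)
  have hDall : ∀ i : ℕ, |b (i + 1) - b i| ≤ D * ρ ^ i := by
    intro i
    have hρi : 0 < ρ ^ i := pow_pos hρ0 i
    by_cases hi : k₀ ≤ i
    · calc |b (i + 1) - b i| ≤ 2 * C' * ρ ^ i := hδ_large i hi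
        _ ≤ D * ρ ^ i := by
            apply mul_le_mul_of_nonneg_right _ hρi.le
            simp only [hD]
            linarith
    · push Not at hi
      have hmem : i ∈ Finset.range k₀ := Finset.mem_range.2 hi
      have hle : |b (i + 1) - b i| / ρ ^ i ≤ ∑ j ∈ Finset.range k₀, |b (j + 1) - b j| / ρ ^ j :=
        Finset.single_le_sum (f := fun j => |b (j + 1) - b j| / ρ ^ j)
          (fun j _ => div_nonneg (abs_nonneg _) (pow_nonneg hρ0.le j)) hmem
      calc |b (i + 1) - b i| = (|b (i + 1) - b i| / ρ ^ i) * ρ ^ i := by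
            field_simp
        _ ≤ (∑ j ∈ Finset.range k₀, |b (j + 1) - b j| / ρ ^ j) * ρ ^ i :=
            mul_le_mul_of_nonneg_right hle hρi.le
        _ ≤ D * ρ ^ i := by
            apply mul_le_mul_of_nonneg_right _ hρi.le
            simp only [hD]
            linarith
  have hdist : ∀ i : ℕ, dist (b i) (b (i + 1)) ≤ D * ρ ^ i := fun i => by
    rw [Real.dist_eq, abs_sub_comm]
    exact hDall i
  have hcs := cauchySeq_of_le_geometric ρ D hρ1 hdist
  obtain ⟨w, hw⟩ := cauchySeq_tendsto_of_complete hcs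
  -- exponentiate: `g(2^k)·(2^k)^{2Δ} = exp (b k) → exp w > 0`
  refine ⟨Δ, Real.exp w, Real.exp_pos w, ?_⟩
  have hexp : Tendsto (fun k : ℕ => Real.exp (b k)) atTop (𝓝 (Real.exp w)) :=
    (Real.continuous_exp.tendsto w).comp hw
  refine hexp.congr fun k => ?_
  simp only [hb]
  rw [Real.exp_add, Real.exp_log (g_pos _), exp_two_mul_mul_log_two]

end Summit.CriticalPhenomena.Ising3DConformalLimit.Cruxes.IsingEuclidUpgradeR2RotInvPowerLaw.TowerProfileRigidity

end
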